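import Summits.AtomisticToContinuum.Crystallization.Theorems.ChartedZeroExcessLayeredLatticeLiouvilleZZZYLA

/-!
# ChartedZeroExcessLayeredLatticeLiouville · NODE 95 «LedgerWindow» (lens-2 g95, ZZZYL) — part B (sequel of `…ChartedZeroExcessLayeredLatticeLiouvilleZZZYLA`)

Split for the 400-line cap by the landing lane (hand-2 g44); the module docstring of part A describes the whole node.  Same namespace; all FQNs unchanged.
0 sorry; standard axioms.
-/

noncomputable section
open scoped BigOperators Classical InnerProductSpace RealInnerProductSpace
open MeasureTheory Set Metric Filter Topology
open Literature.MathematicalPhysics.StatisticalMechanics (lennardJones interactionEnergy)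

namespace Summit.AtomisticToContinuum.Crystallization.Theorems.ChartedZeroExcessLayeredLatticeLiouville
open Summit.AtomisticToContinuum.Crystallization.Theorems.ChartedPlanarOrderRigidityDoor (E3 IsClean)
open Summit.AtomisticToContinuum.Crystallization.Theorems.ChartedPlanarOrderDensityDichotomy (μS IsSep)
open Summit.AtomisticToContinuum.Crystallization.Theorems.ChartedPlanarOrderCleanScaleP (IsCleanP IsDoorSetP)
open Summit.AtomisticToContinuum.Crystallization.Theorems.ChartedPlanarOrderMesoCut (LayeredHom EnvClose)
open Summit.AtomisticToContinuum.Crystallization.Theorems.ChartedPlanarOrderDoorLayeredOsc (IsTwoShellAffineGood)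
open Summit.AtomisticToContinuum.Crystallization.Theorems.ChartedPlanarOrderNashForceBalance (ljDeriv pairDeriv hasDerivAt_lennardJones hasFDerivAt_pair
  norm_pairDeriv_le inv_pow_le_of_half_le inv_pow_add_le)

section Pieces

variable {ϑc ϑ ϑp r rΘ q rsh ρ rm σ ϑr Rs ε rI ℓ Rg sb₁ dI₁ dB₁ sbp dIp dBp Rd τ c c' g₀ aHi Λ θ s : ℝ}

/-- ★★★ **THE GLUE OF NODE 95 (PROVED, all dials): (LDᴸ) ∧ (QLᴸ)(c) ⟹ (BCᴸ)(c).**  THE LEDGER IDENTITY: `E(z) − E(y) = E(z) − E(y) − Λ(z − y)` (criticality: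
`Λ = 0` by `HasFDerivAt.unique`) `= Σ_{i<j} [V(‖z_i − z_j‖) − V(‖y_i − y_j‖) − pairDeriv (y i) (y j) (v_i − v_j)] + Σ_i Σ'_q [V(‖z_i − q‖) − V(‖y_i − q‖) −
pairDeriv (y i) q v_i]` (`v = z − y`; `tsum` linearity on the summable exterior), and each bracket dominates its `pairLedgerLower` (`pairLedgerLower_le_pairTerm`,
`y` injective and off `X`), so `E(z) − E(y) ≥` the ledger sum `≥ c · pairDevSq`. [this file, g95] -/
theorem softBregmanCoerciveP_of_ledger
    (hLD : FirstVariationP ϑc ϑ ϑp r rΘ q rsh ρ rm σ ϑr Rs ε rI ℓ Rg sb₁ dI₁ dB₁ aHi Λ θ s)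
    (hQL : SoftLedgerFloorP ϑc ϑ ϑp r rΘ q rsh ρ rm σ ϑr Rs ε rI ℓ Rg sb₁ dI₁ dB₁ sbp dIp dBp Rd τ c aHi Λ θ s) :
    SoftBregmanCoerciveP ϑc ϑ ϑp r rΘ q rsh ρ rm σ ϑr Rs ε rI ℓ Rg sb₁ dI₁ dB₁ sbp dIp dBp Rd τ c aHi Λ θ s := by
  intro δ hδ a ha S hS hsum hgood L w hLw x₀ K hKS hKq hmild hcool n xf hxf hrange L' w' U t hC lab hlab y hy hyinj hydisj hcrit htame hmin z hz hsoft
  obtain ⟨Λ', hΛ', hsumD, hΛw⟩ := hLD δ hδ a ha S hS hsum hgood L w hLw x₀ K hKS hKq hmild hcool n xf hxf hrange L' w' U t hC lab hlab y hy hyinj hydisj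
    hcrit htame hmin
  obtain ⟨hsumL, hQ⟩ := hQL δ hδ a ha S hS hsum hgood L w hLw x₀ K hKS hKq hmild hcool n xf hxf hrange L' w' U t hC lab hlab y hy hyinj hydisj hcrit
    htame hmin z hz hsoft
  set X : Set E3 := S \ coreOf S K ρ with hX
  -- criticality: the first variation vanishes
  have hΛ0 : Λ' = 0 := hΛ'.unique hcrit
  have hlin : (∑ i, ∑ j ∈ Finset.Ioi i, pairDeriv (y i) (y j) ((z i - y i) - (z j - y j))) +
      ∑ i, ∑' q' : ↥X, pairDeriv (y i) (q' : E3) (z i - y i) = 0 := by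
    have e := hΛw (z - y)
    rw [hΛ0] at e
    simpa using e.symm
  -- summability of the exterior families
  have hsumV : ∀ x : E3, Summable fun q' : ↥X => lennardJones (dist x (q' : E3)) := fun x =>
    summable_subset (g := fun q => lennardJones (dist x q)) (hsum x) fun _ hq => hq.1
  have hy_ne : ∀ (i : Fin n) (q' : ↥X), y i ≠ (q' : E3) := fun i q' h =>
    (Set.disjoint_left.1 hydisj (Set.mem_range_self i)) (h ▸ q'.2)
  -- bondwise domination, interior and exterior
  have hint : ∀ i j : Fin n, j ∈ Finset.Ioi i →
      pairLedgerLower (y i - y j) ((z i - z j) - (y i - y j)) ≤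
        lennardJones (dist (z i) (z j)) - lennardJones (dist (y i) (y j)) - pairDeriv (y i) (y j) ((z i - y i) - (z j - y j)) := by
    intro i j hj
    have hij : y i ≠ y j := fun h => (Finset.mem_Ioi.1 hj).ne (hyinj h)
    have key := pairLedgerLower_le_pairTerm hij ((z i - y i) - (z j - y j))
    have e1 : y i + ((z i - y i) - (z j - y j)) - y j = z i - z j := by abel
    have e2 : (z i - z j) - (y i - y j) = (z i - y i) - (z j - y j) := by abel
    rw [e1] at key
    rw [e2, dist_eq_norm, dist_eq_norm]
    exact key
  have hext : ∀ (i : Fin n) (q' : ↥X),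
      pairLedgerLower (y i - (q' : E3)) (z i - y i) ≤
        lennardJones (dist (z i) (q' : E3)) - lennardJones (dist (y i) (q' : E3)) - pairDeriv (y i) (q' : E3) (z i - y i) := by
    intro i q'
    have key := pairLedgerLower_le_pairTerm (hy_ne i q') (z i - y i)
    have e1 : y i + (z i - y i) - (q' : E3) = z i - (q' : E3) := by abel
    rw [e1] at key
    rw [dist_eq_norm, dist_eq_norm]
    exact key
  -- the exterior tsums, bond by bond
  have hext_sum : ∀ i : Fin n, ∑' q' : ↥X, pairLedgerLower (y i - (q' : E3)) (z i - y i) ≤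
      (∑' q' : ↥X, lennardJones (dist (z i) (q' : E3))) - (∑' q' : ↥X, lennardJones (dist (y i) (q' : E3))) -
        ∑' q' : ↥X, pairDeriv (y i) (q' : E3) (z i - y i) := by
    intro i
    have hs3 : Summable fun q' : ↥X =>
        lennardJones (dist (z i) (q' : E3)) - lennardJones (dist (y i) (q' : E3)) - pairDeriv (y i) (q' : E3) (z i - y i) :=
      ((hsumV (z i)).sub (hsumV (y i))).sub (hsumD i (z i - y i))
    have h1 := (hsumL i).tsum_le_tsum (hext i) hs3
    rw [((hsumV (z i)).sub (hsumV (y i))).tsum_sub (hsumD i (z i - y i)), (hsumV (z i)).tsum_sub (hsumV (y i))] at h1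
    exact h1
  -- the interior finite sums
  have hint_sum : (∑ i, ∑ j ∈ Finset.Ioi i, pairLedgerLower (y i - y j) ((z i - z j) - (y i - y j))) ≤
      ∑ i, ∑ j ∈ Finset.Ioi i,
        (lennardJones (dist (z i) (z j)) - lennardJones (dist (y i) (y j)) - pairDeriv (y i) (y j) ((z i - y i) - (z j - y j))) :=
    Finset.sum_le_sum fun i _ => Finset.sum_le_sum fun j hj => hint i j hj
  have hext_tot : (∑ i, ∑' q' : ↥X, pairLedgerLower (y i - (q' : E3)) (z i - y i)) ≤
      ∑ i, ((∑' q' : ↥X, lennardJones (dist (z i) (q' : E3))) - (∑' q' : ↥X, lennardJones (dist (y i) (q' : E3))) -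
        ∑' q' : ↥X, pairDeriv (y i) (q' : E3) (z i - y i)) :=
    Finset.sum_le_sum fun i _ => hext_sum i
  -- assemble
  have hEz : clampedEnergy X z = (∑ i, ∑ j ∈ Finset.Ioi i, lennardJones (dist (z i) (z j))) + ∑ i, ∑' q' : ↥X, lennardJones (dist (z i) (q' : E3)) := rfl
  have hEy : clampedEnergy X y = (∑ i, ∑ j ∈ Finset.Ioi i, lennardJones (dist (y i) (y j))) + ∑ i, ∑' q' : ↥X, lennardJones (dist (y i) (q' : E3)) := rfl
  rw [hEz, hEy]
  simp only [Finset.sum_sub_distrib] at hint_sum hext_tot hlin ⊢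
  linarith [hint_sum, hext_tot, hlin, hQ]

/-- ★★ **NODE 95 AT THE RECORD DIALS (PROVED): (KAᴸ′) ∧ (LDᴸ′) ∧ (QLᴸ′)(c ≥ 0) ∧ (OGʰ′)(g₀) ⟹ (OGᴹ′)(min (c·(sb − sb₁)²) g₀)** — tree ZZZYI's
`offTubeGapMinP_record_of_capture_hard` with (BCᴸ′) supplied by the ledger glue. [this file, g95] -/
theorem offTubeGapMinP_record_of_ledger {σ ϑc ϑ sb₁ dI₁ dB₁ sbp dIp dBp Rd τ c g₀ : ℝ} (hσ : 1 / 2 ≤ σ) (hsb : sb₁ ≤ 249 / 5000) (hc : 0 ≤ c)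
    (hKA : SoftCaptureP ϑc (1 / 10) 8 (145 / 16) 4 12 16 16 σ (1 / 10000) 5 (1 / 10000) 10 (43 / 2) (121 / 25) sb₁ dI₁ dB₁ sbp dIp dBp Rd τ 1 2
      (1 / 16) (1 / 50))
    (hLD : FirstVariationP ϑc ϑ (1 / 10) 8 (145 / 16) 4 12 16 16 σ (1 / 10000) 5 (1 / 10000) 10 (43 / 2) (121 / 25) sb₁ dI₁ dB₁ 1 2 (1 / 16) (1 / 50))
    (hQL : SoftLedgerFloorP ϑc ϑ (1 / 10) 8 (145 / 16) 4 12 16 16 σ (1 / 10000) 5 (1 / 10000) 10 (43 / 2) (121 / 25) sb₁ dI₁ dB₁ sbp dIp dBp Rd τ c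
      1 2 (1 / 16) (1 / 50))
    (hH : OffTubeHardGapMinP ϑc ϑ (1 / 10) 8 (145 / 16) 4 12 16 16 σ (1 / 10000) 5 (1 / 10000) 10 (43 / 2) (121 / 25) (249 / 5000) (249 / 5000)
      (21 / 50) sb₁ dI₁ dB₁ Rd τ g₀ 1 2 (1 / 16) (1 / 50)) :
    OffTubeGapMinP ϑc ϑ (1 / 10) 8 (145 / 16) 4 12 16 16 σ (1 / 10000) 5 (1 / 10000) 10 (43 / 2) (121 / 25) (249 / 5000) (249 / 5000) (21 / 50)
      sb₁ dI₁ dB₁ (min (c * (249 / 5000 - sb₁) ^ 2) g₀) 1 2 (1 / 16) (1 / 50) :=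
  offTubeGapMinP_record_of_capture_hard hσ hsb hc hKA (softBregmanCoerciveP_of_ledger hLD hQL) hH

/-- ★★★ **THE DOOR W2k (PROVED): `ϑc ≤ 5·10⁻¹²`, (X1ᴸ′)(lam > 0), (X2ᴸ′), (KAᴸ′), (LDᴸ′), (QLᴸ′)(c > 0) and (OGʰ′⋆)(g₀ > 0) ⟹ `[MCMC♮](ϑc)`** at the
registered pair `(Rd, τ⋆) = (121/25, 249/10000)` — tree W2h with its Bregman leaf (BCᴸ′) replaced by NODE 95's two pieces. [this file, g95] -/
theorem mildCoherentMoatCorePG_W2k {ϑc sb₁ dI₁ dB₁ sbp dIp dBp lam c g₀ : ℝ} (hϑc : ϑc ≤ 1 / 200000000000) (hlam : 0 < lam) (hc : 0 < c) (hg₀ : 0 < g₀)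
    (hsb : 4 * sb₁ ≤ 249 / 5000) (hdI : 4 * dI₁ ≤ 249 / 5000) (hdB : dB₁ ≤ 2 / 5) (hsb₀ : 0 ≤ sb₁) (hdI₀ : 0 ≤ dI₁) (hdB₀ : 0 ≤ dB₁)
    (hX1 : LabelTubeConvexityP ϑc tameRadius (1 / 10) 8 (145 / 16) 4 12 16 16 (27 / 32) (1 / 10000) 5 (1 / 10000) 10 (43 / 2) (1 / 5000) (121 / 25)
      (249 / 5000) (249 / 5000) (21 / 50) lam 1 2 (1 / 16) (1 / 50))
    (hX2 : LabelLoadedTubeAprioriP ϑc tameRadius (1 / 10) 8 (145 / 16) 4 12 16 16 (27 / 32) (1 / 10000) 5 (1 / 10000) 10 (43 / 2) (1 / 5000)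
      (121 / 25) (249 / 5000) (249 / 5000) (21 / 50) sb₁ dI₁ dB₁ 1 2 (1 / 16) (1 / 50))
    (hKA : SoftCaptureP ϑc (1 / 10) 8 (145 / 16) 4 12 16 16 (27 / 32) (1 / 10000) 5 (1 / 10000) 10 (43 / 2) (121 / 25) sb₁ dI₁ dB₁ sbp dIp dBp
      (121 / 25) (249 / 10000) 1 2 (1 / 16) (1 / 50))
    (hLD : FirstVariationP ϑc tameRadius (1 / 10) 8 (145 / 16) 4 12 16 16 (27 / 32) (1 / 10000) 5 (1 / 10000) 10 (43 / 2) (121 / 25) sb₁ dI₁ dB₁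
      1 2 (1 / 16) (1 / 50))
    (hQL : SoftLedgerFloorP ϑc tameRadius (1 / 10) 8 (145 / 16) 4 12 16 16 (27 / 32) (1 / 10000) 5 (1 / 10000) 10 (43 / 2) (121 / 25) sb₁ dI₁ dB₁
      sbp dIp dBp (121 / 25) (249 / 10000) c 1 2 (1 / 16) (1 / 50))
    (hH : OffTubeHardGapMinP ϑc tameRadius (1 / 10) 8 (145 / 16) 4 12 16 16 (27 / 32) (1 / 10000) 5 (1 / 10000) 10 (43 / 2) (121 / 25) (249 / 5000)
      (249 / 5000) (21 / 50) sb₁ dI₁ dB₁ (121 / 25) (249 / 10000) g₀ 1 2 (1 / 16) (1 / 50)) :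
    MildCoherentMoatCorePG ϑc tameRadius (1 / 10) 8 4 12 16 1 2 (1 / 16) (1 / 50) :=
  mildCoherentMoatCorePG_W2h hϑc hlam hc hg₀ hsb hdI hdB hsb₀ hdI₀ hdB₀ hX1 hX2 hKA (softBregmanCoerciveP_of_ledger hLD hQL) hH

end Pieces

/-! ### ZZZYL-3  (LDᴸ) PROVED: the first variation of the clamped energy at a filling off the frozen set; door W2l -/

section FirstVariation

/-- ★ **POSITIVE CLEARANCE (PROVED)**: a point off a `δ`-separated set is at a uniform positive distance from it (at most one site lies within `δ/2`). [this file, g95] -/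
theorem exists_pos_le_dist_of_isSep {δ : ℝ} (hδ : 0 < δ) {X : Set E3} (hsep : IsSep δ X) {p : E3} (hp : p ∉ X) :
    ∃ t : ℝ, 0 < t ∧ ∀ q ∈ X, t ≤ dist p q := by
  by_cases h : ∃ q₀ ∈ X, dist p q₀ < δ / 2
  · obtain ⟨q₀, hq₀, hd⟩ := h
    have hpq : 0 < dist p q₀ := dist_pos.2 fun e => hp (e ▸ hq₀)
    refine ⟨min (dist p q₀) (δ / 2), lt_min hpq (half_pos hδ), fun q hq => ?_⟩
    by_cases hqq : q = q₀
    · rw [hqq]; exact min_le_left _ _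
    · refine (min_le_right _ _).trans ?_
      by_contra hlt
      rw [not_le] at hlt
      have hfar := hsep q₀ hq₀ q hq (Ne.symm hqq)
      have htri := dist_triangle q₀ p q
      rw [dist_comm q₀ p] at htri
      linarith
  · refine ⟨δ / 2, half_pos hδ, fun q hq => ?_⟩
    by_contra hlt
    exact h ⟨q, hq, (not_le.1 hlt)⟩

/-- ★★ **THE EXTERIOR SITE SUM IS DIFFERENTIABLE OFF THE FROZEN SET (PROVED)** — tree N-force-balance's `hasFDerivAt_siteEnergy` ported from an atom to an
ARBITRARY base point `p` with clearance `t > 0` from the `δ`-separated frozen set `X`: `x ↦ Σ'_{q ∈ X} V(dist x q)` has Fréchet derivative `Σ'_q pairDeriv p q`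
at `p`, the series of pair derivatives converging absolutely (dominated differentiation on the ball `B(p, t/2)`, `r⁻⁶` tail by the tree's grid count
`summable_inv_pow_six_far`). [this file, g95] -/
theorem hasFDerivAt_tsum_exterior_of_clear {δ t : ℝ} (hδ : 0 < δ) {X : Set E3} (hsep : IsSep δ X) {p : E3} (ht : 0 < t)
    (hclear : ∀ q ∈ X, t ≤ dist p q) (hsum0 : Summable fun q : X => lennardJones (dist p (q : E3))) :
    HasFDerivAt (fun x : E3 => ∑' q : X, lennardJones (dist x (q : E3))) (∑' q : X, pairDeriv p (q : E3)) p ∧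
      Summable (fun q : X => pairDeriv p (q : E3)) := by
  set Kt : ℝ := 2 ^ 13 * (t⁻¹) ^ 7 + 2 ^ 7 * t⁻¹ with hKt
  -- inverse sixth powers over the frozen set, from the clearance
  have hmem : ∀ q : X, (q : E3) ∈ X ∧ t / 2 < dist (q : E3) p := fun q =>
    ⟨q.2, by have h := hclear q q.2; rw [dist_comm] at h; linarith⟩
  have hinj : Function.Injective (fun q : X => (⟨(q : E3), hmem q⟩ : {q : E3 // q ∈ X ∧ t / 2 < dist q p})) := by
    intro q q' hqq
    have h := congrArg Subtype.val hqq
    exact Subtype.ext h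
  have h6 : Summable fun q : X => (‖p - (q : E3)‖⁻¹) ^ 6 :=
    ((summable_inv_pow_six_far hδ hsep p (half_pos ht)).comp_injective hinj).congr fun q => rfl
  have hu : Summable fun q : X => Kt * (‖p - (q : E3)‖⁻¹) ^ 6 := h6.mul_left Kt
  have hρ : ∀ q : X, t ≤ ‖p - (q : E3)‖ := fun q => by rw [← dist_eq_norm]; exact hclear q q.2
  have hball : ∀ q : X, ∀ y ∈ ball p (t / 2), ‖p - (q : E3)‖ / 2 ≤ ‖y - (q : E3)‖ := fun q y hy => by
    rw [mem_ball, dist_eq_norm] at hy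
    have h1 := norm_sub_le_norm_sub_add_norm_sub p y (q : E3)
    have h2 : ‖p - y‖ = ‖y - p‖ := norm_sub_rev _ _
    linarith [hρ q]
  have hne : ∀ q : X, ∀ y ∈ ball p (t / 2), y ≠ (q : E3) := fun q y hy h => by
    have := hball q y hy
    rw [h, sub_self, norm_zero] at this
    linarith [hρ q]
  have hderiv : ∀ q : X, ∀ y ∈ ball p (t / 2), HasFDerivAt (fun x : E3 => lennardJones ‖x - (q : E3)‖) (pairDeriv y (q : E3)) y :=
    fun q y hy => hasFDerivAt_pair (hne q y hy)
  have hbound : ∀ q : X, ∀ y ∈ ball p (t / 2), ‖pairDeriv y (q : E3)‖ ≤ Kt * (‖p - (q : E3)‖⁻¹) ^ 6 := by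
    intro q y hy
    have hρ0 : 0 < ‖p - (q : E3)‖ := ht.trans_le (hρ q)
    have h13 := inv_pow_le_of_half_le hρ0 (hball q y hy) 13
    have h7 := inv_pow_le_of_half_le hρ0 (hball q y hy) 7
    have h13' := inv_pow_add_le ht (hρ q) 7
    have h7' := inv_pow_add_le ht (hρ q) 1
    rw [show 6 + 7 = 13 from rfl] at h13'
    rw [show 6 + 1 = 7 from rfl, pow_one] at h7'
    calc ‖pairDeriv y (q : E3)‖ ≤ (‖y - (q : E3)‖⁻¹) ^ 13 + (‖y - (q : E3)‖⁻¹) ^ 7 := norm_pairDeriv_le (hne q y hy)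
      _ ≤ 2 ^ 13 * (‖p - (q : E3)‖⁻¹) ^ 13 + 2 ^ 7 * (‖p - (q : E3)‖⁻¹) ^ 7 := add_le_add h13 h7
      _ ≤ 2 ^ 13 * ((t⁻¹) ^ 7 * (‖p - (q : E3)‖⁻¹) ^ 6) + 2 ^ 7 * (t⁻¹ * (‖p - (q : E3)‖⁻¹) ^ 6) := by gcongr
      _ = Kt * (‖p - (q : E3)‖⁻¹) ^ 6 := by rw [hKt]; ring
  have hp0 : p ∈ ball p (t / 2) := mem_ball_self (half_pos ht)
  have hsum0' : Summable fun q : X => lennardJones ‖p - (q : E3)‖ := by simpa only [dist_eq_norm] using hsum0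
  have hmain := hasFDerivAt_tsum_of_isPreconnected hu isOpen_ball (convex_ball p (t / 2)).isPreconnected hderiv hbound hp0 hsum0' hp0
  have hfun : (fun x : E3 => ∑' q : X, lennardJones ‖x - (q : E3)‖) = fun x => ∑' q : X, lennardJones (dist x (q : E3)) := by
    funext x; simp only [dist_eq_norm]
  rw [hfun] at hmain
  exact ⟨hmain, Summable.of_norm_bounded hu fun q => hbound q p hp0⟩

variable {ϑc ϑ ϑp r rΘ q rsh ρ rm σ ϑr Rs ε rI ℓ Rg sb₁ dI₁ dB₁ sbp dIp dBp Rd τ c g₀ aHi Λ θ s : ℝ}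

/-- ★★★ **(LDᴸ) PROVED — `firstVariationP_holds : FirstVariationP …` at ALL dials.**  The clamped energy `E = clampedEnergy (S ∖ core)` has a Fréchet derivative at
every injective filling `y` off the frozen set, equal to the pair-derivative functional (interior pairs by tree `hasFDerivAt_pair`, exterior sums by
`hasFDerivAt_tsum_exterior_of_clear` at the clearance of `exists_pos_le_dist_of_isSep`; the frozen set `S ∖ core` is `δ`-separated by `IsDoorSetP`).  Hence the
ledger cut of NODE 95 has ONE open piece: (BCᴸ′) ⟸ (QLᴸ′) (`softBregmanCoerciveP_of_ledgerFloor`). [this file, g95] -/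
theorem firstVariationP_holds : FirstVariationP ϑc ϑ ϑp r rΘ q rsh ρ rm σ ϑr Rs ε rI ℓ Rg sb₁ dI₁ dB₁ aHi Λ θ s := by
  intro δ hδ a ha S hS hsum hgood L w hLw x₀ K hKS hKq hmild hcool n xf hxf hrange L' w' U t hC lab hlab y hy hyinj hydisj hcrit htame hmin
  set X : Set E3 := S \ coreOf S K ρ with hX
  have hsepX : IsSep δ X := fun p₁ hp₁ p₂ hp₂ hne => hS.2.1 p₁ hp₁.1 p₂ hp₂.1 hne
  have hyX : ∀ i, y i ∉ X := fun i h => (Set.disjoint_left.1 hydisj (Set.mem_range_self i)) h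
  have hsumX : ∀ z : E3, Summable fun q' : ↥X => lennardJones (dist z (q' : E3)) := fun z =>
    summable_subset (g := fun q' => lennardJones (dist z q')) (hsum z) fun _ hq => hq.1
  have hext : ∀ i : Fin n, HasFDerivAt (fun x : E3 => ∑' q' : ↥X, lennardJones (dist x (q' : E3))) (∑' q' : ↥X, pairDeriv (y i) (q' : E3)) (y i) ∧
      Summable (fun q' : ↥X => pairDeriv (y i) (q' : E3)) := fun i => by
    obtain ⟨t₀, ht₀, hclear⟩ := exists_pos_le_dist_of_isSep hδ hsepX (hyX i)
    exact hasFDerivAt_tsum_exterior_of_clear hδ hsepX ht₀ hclear (hsumX (y i))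
  refine ⟨(∑ i, ∑ j ∈ Finset.Ioi i, (pairDeriv (y i) (y j)).comp ((ContinuousLinearMap.proj i : (Fin n → E3) →L[ℝ] E3) - ContinuousLinearMap.proj j)) +
      ∑ i, (∑' q' : ↥X, pairDeriv (y i) (q' : E3)).comp (ContinuousLinearMap.proj i : (Fin n → E3) →L[ℝ] E3), ?_, fun i u => ?_, fun w₁ => ?_⟩
  · -- the derivative
    have hE : (fun z : Fin n → E3 => clampedEnergy X z) = fun z =>
        (∑ i, ∑ j ∈ Finset.Ioi i, lennardJones (dist (z i) (z j))) + ∑ i, ∑' q' : ↥X, lennardJones (dist (z i) (q' : E3)) := rfl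
    rw [hE]
    refine HasFDerivAt.add ?_ ?_
    · have hterm : ∀ i j : Fin n, j ∈ Finset.Ioi i → HasFDerivAt (fun z : Fin n → E3 => lennardJones (dist (z i) (z j)))
          ((pairDeriv (y i) (y j)).comp ((ContinuousLinearMap.proj i : (Fin n → E3) →L[ℝ] E3) - ContinuousLinearMap.proj j)) y := by
        intro i j hj
        have hne : y i ≠ y j := fun h => (Finset.mem_Ioi.1 hj).ne (hyinj h)
        have hinner : HasFDerivAt (fun z : Fin n → E3 => z i - z j + y j)
            ((ContinuousLinearMap.proj i : (Fin n → E3) →L[ℝ] E3) - ContinuousLinearMap.proj j) y :=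
          ((hasFDerivAt_apply (𝕜 := ℝ) i y).sub (hasFDerivAt_apply (𝕜 := ℝ) j y)).add_const (y j)
        have houter : HasFDerivAt (fun u : E3 => lennardJones ‖u - y j‖) (pairDeriv (y i) (y j)) (y i - y j + y j) := by
          rw [sub_add_cancel]; exact hasFDerivAt_pair hne
        have hcomp := houter.comp y hinner
        have hfun : (fun z : Fin n → E3 => lennardJones (dist (z i) (z j))) = (fun u : E3 => lennardJones ‖u - y j‖) ∘ fun z : Fin n → E3 => z i - z j + y j := by
          funext z; simp [dist_eq_norm]
        rw [hfun]; exact hcomp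
      have hrow : ∀ i ∈ (Finset.univ : Finset (Fin n)), HasFDerivAt (fun z : Fin n → E3 => ∑ j ∈ Finset.Ioi i, lennardJones (dist (z i) (z j)))
          (∑ j ∈ Finset.Ioi i, (pairDeriv (y i) (y j)).comp ((ContinuousLinearMap.proj i : (Fin n → E3) →L[ℝ] E3) - ContinuousLinearMap.proj j)) y := by
        intro i _
        have h := HasFDerivAt.sum fun j hj => hterm i j hj
        rwa [Finset.sum_fn] at h
      have h := HasFDerivAt.sum hrow
      rwa [Finset.sum_fn] at h
    · have hrow : ∀ i ∈ (Finset.univ : Finset (Fin n)), HasFDerivAt (fun z : Fin n → E3 => ∑' q' : ↥X, lennardJones (dist (z i) (q' : E3)))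
          ((∑' q' : ↥X, pairDeriv (y i) (q' : E3)).comp (ContinuousLinearMap.proj i : (Fin n → E3) →L[ℝ] E3)) y := fun i _ => by
        have h := (hext i).1.comp y (hasFDerivAt_apply (𝕜 := ℝ) i y)
        exact h
      have h := HasFDerivAt.sum hrow
      rwa [Finset.sum_fn] at h
  · -- summability of the evaluated exterior pair derivatives
    exact (((ContinuousLinearMap.apply ℝ ℝ u).summable (hext i).2)).congr fun q' => by simp
  · -- the formula
    have happ : ∀ i : Fin n, (∑' q' : ↥X, pairDeriv (y i) (q' : E3)) (w₁ i) = ∑' q' : ↥X, pairDeriv (y i) (q' : E3) (w₁ i) := fun i => by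
      have e := (ContinuousLinearMap.apply ℝ ℝ (w₁ i)).map_tsum (hext i).2
      simpa only [ContinuousLinearMap.apply_apply] using e
    simp [happ]

/-- ★★★ **THE ONE-PIECE GLUE (PROVED): (QLᴸ)(c) ⟹ (BCᴸ)(c)** at all dials. [this file, g95] -/
theorem softBregmanCoerciveP_of_ledgerFloor
    (hQL : SoftLedgerFloorP ϑc ϑ ϑp r rΘ q rsh ρ rm σ ϑr Rs ε rI ℓ Rg sb₁ dI₁ dB₁ sbp dIp dBp Rd τ c aHi Λ θ s) :
    SoftBregmanCoerciveP ϑc ϑ ϑp r rΘ q rsh ρ rm σ ϑr Rs ε rI ℓ Rg sb₁ dI₁ dB₁ sbp dIp dBp Rd τ c aHi Λ θ s :=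
  softBregmanCoerciveP_of_ledger firstVariationP_holds hQL

/-- ★★★ **THE DOOR W2l (PROVED): `ϑc ≤ 5·10⁻¹²`, (X1ᴸ′)(lam > 0), (X2ᴸ′), (KAᴸ′), (QLᴸ′)(c > 0) and (OGʰ′⋆)(g₀ > 0) ⟹ `[MCMC♮](ϑc)`** — W2k with (LDᴸ′)
discharged by `firstVariationP_holds`: on the ledger branch the Bregman leaf (BCᴸ′) of tree W2h is now carried by the SINGLE typed piece (QLᴸ′). [this file, g95] -/
theorem mildCoherentMoatCorePG_W2l {ϑc sb₁ dI₁ dB₁ sbp dIp dBp lam c g₀ : ℝ} (hϑc : ϑc ≤ 1 / 200000000000) (hlam : 0 < lam) (hc : 0 < c) (hg₀ : 0 < g₀)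
    (hsb : 4 * sb₁ ≤ 249 / 5000) (hdI : 4 * dI₁ ≤ 249 / 5000) (hdB : dB₁ ≤ 2 / 5) (hsb₀ : 0 ≤ sb₁) (hdI₀ : 0 ≤ dI₁) (hdB₀ : 0 ≤ dB₁)
    (hX1 : LabelTubeConvexityP ϑc tameRadius (1 / 10) 8 (145 / 16) 4 12 16 16 (27 / 32) (1 / 10000) 5 (1 / 10000) 10 (43 / 2) (1 / 5000) (121 / 25)
      (249 / 5000) (249 / 5000) (21 / 50) lam 1 2 (1 / 16) (1 / 50))
    (hX2 : LabelLoadedTubeAprioriP ϑc tameRadius (1 / 10) 8 (145 / 16) 4 12 16 16 (27 / 32) (1 / 10000) 5 (1 / 10000) 10 (43 / 2) (1 / 5000)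
      (121 / 25) (249 / 5000) (249 / 5000) (21 / 50) sb₁ dI₁ dB₁ 1 2 (1 / 16) (1 / 50))
    (hKA : SoftCaptureP ϑc (1 / 10) 8 (145 / 16) 4 12 16 16 (27 / 32) (1 / 10000) 5 (1 / 10000) 10 (43 / 2) (121 / 25) sb₁ dI₁ dB₁ sbp dIp dBp
      (121 / 25) (249 / 10000) 1 2 (1 / 16) (1 / 50))
    (hQL : SoftLedgerFloorP ϑc tameRadius (1 / 10) 8 (145 / 16) 4 12 16 16 (27 / 32) (1 / 10000) 5 (1 / 10000) 10 (43 / 2) (121 / 25) sb₁ dI₁ dB₁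
      sbp dIp dBp (121 / 25) (249 / 10000) c 1 2 (1 / 16) (1 / 50))
    (hH : OffTubeHardGapMinP ϑc tameRadius (1 / 10) 8 (145 / 16) 4 12 16 16 (27 / 32) (1 / 10000) 5 (1 / 10000) 10 (43 / 2) (121 / 25) (249 / 5000)
      (249 / 5000) (21 / 50) sb₁ dI₁ dB₁ (121 / 25) (249 / 10000) g₀ 1 2 (1 / 16) (1 / 50)) :
    MildCoherentMoatCorePG ϑc tameRadius (1 / 10) 8 4 12 16 1 2 (1 / 16) (1 / 50) :=
  mildCoherentMoatCorePG_W2k hϑc hlam hc hg₀ hsb hdI hdB hsb₀ hdI₀ hdB₀ hX1 hX2 hKA firstVariationP_holds hQL hH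

end FirstVariation


end Summit.AtomisticToContinuum.Crystallization.Theorems.ChartedZeroExcessLayeredLatticeLiouville

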